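import Summits.Ventures.HodgeRepro2.T6A2ProjIrreducible
import Summits.Ventures.HodgeRepro2.T6A2WeilHostDatum

/-!
# T6A2ProjectiveSpaceSPVar — `ℙⁿ_k` is a smooth projective variety in the host's
sense; DATA row 12 (`SurfaceDatum C`) is inhabited for every corner product

Cell pub-hodge-repro2, Tier 6 (README §10), seat t6-p2 (A2 owner; gen 12, custodial). Piece (W-e) of the
non-vacuity record for DATA row 12 (`surf : Choice → SurfaceDatum C`, README §10.5(ii)(c)): assembling
(W-c) `smoothOfRelativeDimension_projectiveSpace` (T6A2ProjSmooth), (W-d) `geometricallyIrreducible_projHom`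
(T6A2ProjIrreducible) and the identity embedding, the host's `projectiveSpace n k` (Varieties.lean ll. 40–44)
satisfies the host's `IsSmoothProjective n` (ll. 69–75) — in particular the host's named `Prop`
`isSmoothProjective_projectiveSpace n k` (l. 134) HOLDS. Hence `ℙ²_ℂ` is an `SPVar ℂ` of dimension `2`, and
`SurfaceDatum C` is nonempty for EVERY corner product `C` (the constant map through the unit section of the
abelian variety `C.B`). Everything is proved from Mathlib and the host-api package; no display; no `sorry`;
standard axioms.
§8(d): uses an L-value-free non-vanishing device: NO.
Filed in Tier-6 WAVE 1 (2026-08-26) as p439413 (definition lane, ACCEPTED 10:55Z, commit a315e17e682a); this v2 differs from the filed bytes in this module docstring only (the staged-record wording dropped).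
-/

namespace Summit.Ventures.HodgeRepro2.T6.A2Surface

open HostAPI.Carriers.AlgebraicGeometry.Motives AlgebraicGeometry CategoryTheory

universe u

variable (k : Type u) [Field k] (n : ℕ)

/-- `ℙⁿ_k` is projective over `k`: the identity is a closed immersion into `projectiveSpace n k`. -/
theorem isProjectiveOver_projectiveSpace : IsProjectiveOver (projectiveSpace n k) :=
  ⟨n, 𝟙 _, by rw [Over.id_left]; infer_instance⟩

/-- `ℙⁿ_k` is a smooth projective geometrically irreducible variety of dimension `n` in the host's sense
(`IsSmoothProjective`, Varieties.lean ll. 69–75). -/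
theorem projectiveSpace_isSmoothProjective : IsSmoothProjective n (projectiveSpace n k) where
  smoothOfRelativeDimension := smoothOfRelativeDimension_projectiveSpace k n
  isProjectiveOver := isProjectiveOver_projectiveSpace k n
  geometricallyIrreducible := geometricallyIrreducible_projHom k n

/-- the host's named statement `isSmoothProjective_projectiveSpace k n` (Varieties.lean l. 134) holds -/
theorem isSmoothProjective_projectiveSpace_holds :
    HostAPI.Carriers.AlgebraicGeometry.Motives.isSmoothProjective_projectiveSpace k n :=
  projectiveSpace_isSmoothProjective k n

end Summit.Ventures.HodgeRepro2.T6.A2Surface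

namespace Summit.Ventures.HodgeRepro2.T6.WeilAssembly

open CategoryTheory MonoidalCategory
open HostAPI.Carriers.AlgebraicGeometry.Motives
open Summit.Ventures.HodgeRepro2.T6 Host WeilInst A2Surface

/-- `ℙⁿ_k` as a bundled smooth projective variety of dimension `n` -/
noncomputable def SPVar.projectiveSpace (k : Type) [Field k] (n : ℕ) : SPVar k :=
  ⟨HostAPI.Carriers.AlgebraicGeometry.Motives.projectiveSpace n k, n,
    projectiveSpace_isSmoothProjective k n⟩

/-- a smooth projective surface over `ℂ` exists in the host's sense: `ℙ²_ℂ` -/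
theorem exists_SPVar_dim_two : ∃ S : SPVar ℂ, S.n = 2 := ⟨SPVar.projectiveSpace ℂ 2, rfl⟩

variable {K : Type} [Field K] [NumberField K] [NumberField.IsCMField K]

/-- A surface datum from any smooth projective surface: the constant map through the unit section of `B`. -/
noncomputable def SurfaceDatum.ofSPVar (C : CornerProduct K) (S : SPVar ℂ) (hS : S.n = 2) :
    SurfaceDatum C :=
  ⟨S, hS, CartesianMonoidalCategory.toUnit S.X ≫ MonObj.one⟩

/-- the surface datum `ℙ²_ℂ → B` (constant map through the unit section) -/
noncomputable def SurfaceDatum.ofProjectivePlane (C : CornerProduct K) : SurfaceDatum C :=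
  SurfaceDatum.ofSPVar C (SPVar.projectiveSpace ℂ 2) rfl

/-- NON-VACUITY OF DATA ROW 12 (README §10.5(ii)(c)): `SurfaceDatum C` is nonempty for EVERY corner product
`C`, unconditionally. -/
theorem SurfaceDatum.nonempty (C : CornerProduct K) : Nonempty (SurfaceDatum C) :=
  ⟨SurfaceDatum.ofProjectivePlane C⟩

end Summit.Ventures.HodgeRepro2.T6.WeilAssembly
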